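import Literature.MathematicalPhysics.QuantumFieldTheory.Balaban1983to89.B8Eq115GaugeFixing

/-!
# `Balaban1983to89.B8Ineq133` — B8 p. 99: the cut-off configuration `U₀″` ("equal to `U₀′` on `□̃`, and equal to
# `1` outside `□̃`") and (1.133) `|Ū₀″ʲ − 1| < 6dL²Mα₀` on the tower of cubes, for every orbit

T. Bałaban, *Spaces of regular gauge field configurations on a lattice and gauge fixing conditions*, Commun.
Math. Phys. **99** (1985) 75–102 `[Balaban1985RegularSpaces]` ("B8"), Sect. F p. 99, display (1.131)–(1.133); it
uses the locality of the averages (42)/(43) of T. Bałaban, *Averaging operations for lattice gauge theories*,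
Commun. Math. Phys. **98** (1985) 17–51 `[Balaban1985Averaging]` ("B7", "[3]" in B8), p. 24 / p. 26.  STATUS: a
published, refereed paper; this file REPRODUCES the displayed step (1.133) — justified in print by the six words
"by the construction of `U₀″`, and the inequality (1.130)" — with the locality of (43) that the step silently uses
made explicit and kernel-checked, from the tree's certified forms; nothing here is new mathematics and nothing
here is a claim about the Clay problem.

## THE PRINTED TEXT (quoted from the page images of pp. 98–99)

* p. 98: "Let us take a sequence of cubes `□₀, □₁, …, □_{k−1}, □_k, □`, such that `□_j ⊃ □_{j+1}` and a distance
  between boundaries of these cubes is equal to `R₁M₁Lʲη`. … We cover `□₀` by a smallest family of cubes of the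
  size `R₁M₁`. A sum of these cubes is a cube which we denote by `□̃`. … Of course we assume also that these
  constructions are compatible with the block structure of the lattice `T`, i.e. for every `j` the cube `□_j` is
  a sum of the big blocks of the lattice `T_{L^{−j}}`."
* p. 99: "The sequence of cubes `{□_j}` is an admissible family of subsets satisfying (1.3), (1.4),
  `□_k ⊂ Ω_{k−1}`, `□_j ⊂ Ω_j`, `j < k`. Let us define
  `Λ′_j = □_j^{(j)} \ □_{j+1}^{(j)}`, `j = 1, …, k − 1`, `Λ′_k = □_k^{(k)}`, `Λ′₀ = T \ □₁`,
  `ℭ_k = ⋃_{j=0}^{k} Λ′_j`,                                                                          (1.131)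
  and let us define a configuration `U₀″` as equal to `U₀′` on `□̃`, and equal to `1` outside `□̃`. It satisfies
  the conditions
  `U₀″ ∈ 𝔄_k({□_j}, L³α₀) ∩ Ax_k(ℭ_k, 1)`,                                                           (1.132)
  `|Ū₀″ʲ − 1| < 6dL²Mα₀` on `□_j^{(j)}`, `j = 0, 1, …, k`,                                           (1.133)
  by the construction of `U₀″`, and the inequality (1.130)."
* [3] p. 24: the average (42) "depends only on the bond variables `U_b` for `b ⊂ B(c₋) ∪ B(c₊)`" — the tree's
  `B7Prop1Local.bavg_congr`, iterated on the tower of cubes in `B8Ineq130.agree_level`.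

Since `□_j ⊂ □₀ ⊂ □̃` for every `j`, print's `□_j^{(j)}` is contained in `□̃^{(j)}`; (1.133) is certified below on
all of `□̃^{(j)}`.

## WHAT IS CERTIFIED HERE (kernel, axioms `propext`/`Classical.choice`/`Quot.sound` only)

On the `ℤ^d` tower of `B8Ineq130` (its DICTIONARY: `□̃^{(j)}` ↦ the depth-`n` cube `[tlo n, thi n]` of the
`(k − n)`-th lattice, `n = k − j`; the finest cube `□̃` ↦ `[tlo k, thi k]`), for bond fields valued in an
`AvgClosed` gauge group `G ≤ {|u| ≤ 1, |u⁻¹| ≤ 1}`: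
* `cutCfg lo hi V` — THE CUT-OFF: `V` on the bonds `⟨x, x + e_κ⟩` with both endpoints in `[lo, hi]` and `1` on
  every other bond (print's "equal to `U₀′` on `□̃`, and equal to `1` outside `□̃`"); `cutCfg_agree`,
  `cutCfg_eq_one`, `cutCfg_mem`;
* `pdevOn_congr`, `avgIter_eq_of_agree` — THE LOCALITY the step uses, made explicit: the deviation functional
  (1.7) on the unit plaquettes of a box, and the values of the `(k − n)`-fold averages (43) on the bonds of the
  depth-`n` cube, depend only on the bond variables inside the finest cube (`B8Ineq130.hol_plaqWord_congr`,
  `B8Ineq130.agree_level`);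
* `cutFixed` — print's `U₀″` as a function of `U₀`: the cut-off of the gauge-fixed configuration
  `U₀′ = U₀^{u}`, `u = B8Eq115GaugeFixing.localGauge …` (the block axial tower gauge with the global axial gauge
  of the top level at the center `y`, certified to exist and to be unique up to the normalisation there);
* **`ineq133`** — for EVERY `G`-valued `U₀` with (1.7) on the unit plaquettes of `□̃` and the smallness / size
  hypotheses of `B8Eq115GaugeFixing.ineq130_fixed`: (i) `U₀″` is `G`-valued; (ii) `U₀″ = 1` on every bond not
  contained in `□̃` (and `= U₀′` on the bonds of `□̃`, `cutCfg_agree`); (iii) the (1.7)-part of (1.132) on `□̃`: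
  `sup_{p ⊂ □̃} |U₀″(∂p) − 1| = sup_{p ⊂ □̃} |U₀(∂p) − 1| < α₀L²·L^{−2k}`; (iv) the `Ax`-part of (1.132) in the
  form Sect. F uses it: (1.15) between all consecutive levels `Ū₀″^{j+1} → Ū₀″ʲ` on the tower of cubes and the
  global axial gauge `Ū₀″ᵏ(Γ_{y,z}) = 1` on `□̃^{(k)}`; (v) **(1.133)** on every bond `b` of every `□̃^{(j)}`,
  `j = k − n`, `n = 0, …, k`: `|Ū₀″ʲ_b − 1| < 6dL²Mα₀` — (1.130) (`ineq130_fixed`) transported by locality.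

## DICTIONARY / HONEST SCOPE

* Carriers, `G`, `|·|`, levels, (1.7), (1.15), the top axial condition and all smallness hypotheses EXACTLY as in
  `B8Ineq130` / `B8Eq115GaugeFixing` (every level is `ℤ^d`; `η = L^{−k}` absorbed: (1.7) on `□̃` ↦
  `pdevOn (tlo k) (thi k) U₀ < α₀L²(L^{−k})²`; explicit Prop. 1/2 smallness of [3] instead of "α₀ so small that …
  all the theorems on averaging operations are valid").
* "equal to `U₀′` on `□̃`" ↦ equality on the bonds with BOTH endpoints in the finest cube (the convention of
  `B7Prop1Local.AgreeOn`); a bond leaving `□̃` is "outside" and carries `1`.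
* NOT modelled: the torus `T` and the cubes `□_j`, the sets `Λ′_j`, `ℭ_k` of (1.131) (they serve the classes of
  (1.132); `ℤ^d` replaces `T`, and (1.133) is certified on the larger sets `□̃^{(j)} ⊇ □_j^{(j)}`).
* NOT certified: the regularity class `𝔄_k({□_j}, L³α₀)` of (1.132) beyond its (1.7)-part on `□̃` (the
  conditions (1.8), (1.9) and the constant `L³α₀` are not typed in the tree); the class `Ax_k(ℭ_k, 1)` as defined
  by (1.16)–(1.18) beyond the (1.15)/top-axial form (iv); everything after (1.133) on p. 99 ("If
  `7dL²Mα₀ ≤ c₁`, then the assumptions of Theorem 4 are satisfied …", (1.134), Proposition 6).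
* `<` as printed in (1.133); the first member of (1.130) behind it is the tree's `≤`-form (`B8Ineq130`).
-/

noncomputable section

open scoped BigOperators
open NormedSpace Finset

namespace Literature.MathematicalPhysics.QuantumFieldTheory.Balaban1983to89.B8Ineq133

open B7Prop1Explicit B7Prop2Explicit B7Prop1Local B8Ineq130 B8Eq115GaugeFixing

-- `Site` alone would resolve to the torus sites of `Setup.lean`; re-export the `ℤ^d` sites of `B7Prop1Explicit`.
export B7Prop1Explicit (Site)

variable {d : ℕ}

/-! ## §1. The cut-off configuration (p. 99) over any group -/

section Algebra

variable {G : Type*} [Group G]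

open Classical in
/-- THE CUT-OFF CONFIGURATION of p. 99: "a configuration `U₀″` as equal to `U₀′` on `□̃`, and equal to `1`
outside `□̃`" — `V` on the bonds `⟨x, x + e_κ⟩` with both endpoints in the box `[lo, hi]`, `1` on every other
bond. [cite: Balaban1985RegularSpaces, p.99 (definition of U₀″ before (1.132))] -/
def cutCfg (lo hi : Site d) (V : Site d → Fin d → G) : Site d → Fin d → G := fun x κ =>
  if InBox lo hi x ∧ InBox lo hi (x + e κ) then V x κ else 1

/-- "equal to `U₀′` on `□̃`": the cut-off agrees with `V` on the bonds of the box.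
[cite: Balaban1985RegularSpaces, p.99 (definition of U₀″)] -/
theorem cutCfg_agree (lo hi : Site d) (V : Site d → Fin d → G) : AgreeOn lo hi (cutCfg lo hi V) V :=
  fun x κ hx hxe => by
    unfold cutCfg
    exact if_pos ⟨hx, hxe⟩

/-- "and equal to `1` outside `□̃`": on every bond not contained in the box the cut-off is `1`.
[cite: Balaban1985RegularSpaces, p.99 (definition of U₀″)] -/
theorem cutCfg_eq_one {lo hi : Site d} (V : Site d → Fin d → G) {x : Site d} {κ : Fin d}
    (h : ¬ (InBox lo hi x ∧ InBox lo hi (x + e κ))) : cutCfg lo hi V x κ = 1 := by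
  unfold cutCfg
  exact if_neg h

/-- The cut-off takes values in any subgroup containing the values of `V` (it only adds the value `1`).
[folklore] -/
theorem cutCfg_mem {lo hi : Site d} {S : Subgroup G} {V : Site d → Fin d → G} (hV : ∀ x κ, V x κ ∈ S)
    (x : Site d) (κ : Fin d) : cutCfg lo hi V x κ ∈ S := by
  unfold cutCfg
  split_ifs
  exacts [hV _ _, S.one_mem]

end Algebra

/-! ## §2. Locality of (1.7) on a box and of the averages (43) on the tower, made explicit -/

section Analytic

variable {𝔸 : Type*} [NormedRing 𝔸] [NormOneClass 𝔸]

omit [NormOneClass 𝔸] in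
/-- LOCALITY OF (1.7) ON A BOX: `sup_{p ⊂ [lo, hi]} |V(∂p) − 1|` depends only on the bond variables of the box
(each plaquette variable does, `B8Ineq130.hol_plaqWord_congr`). [cite: Balaban1985Averaging, p.24 ("depends only
on the bond variables"), (44) p.24] -/
theorem pdevOn_congr {lo hi : Site d} {V V' : Site d → Fin d → 𝔸ˣ} (h : AgreeOn lo hi V V') :
    pdevOn lo hi V = pdevOn lo hi V' := by
  unfold pdevOn
  exact iSup_congr fun p => by rw [hol_plaqWord_congr h p.1.1 p.1.2.1 p.1.2.2 p.2.1 p.2.2]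

variable [NormedAlgebra ℂ 𝔸] [CompleteSpace 𝔸]

omit [NormOneClass 𝔸] in
/-- LOCALITY OF THE AVERAGES ON THE TOWER OF CUBES, bondwise: two configurations agreeing on the bonds of the
finest cube `[tlo k, thi k]` have equal `(k − n)`-fold averages (43) on every bond `⟨x, x + e_ν⟩` of the depth-`n`
cube (`B8Ineq130.agree_level`). [cite: Balaban1985Averaging, p.24 (locality of (42)); Balaban1985RegularSpaces,
p.99 ("by the construction of U₀″")] -/
theorem avgIter_eq_of_agree {L : ℕ} (hL : 1 ≤ L) {lo hi : Site d} {k : ℕ} {V V' : Site d → Fin d → 𝔸ˣ}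
    (h : AgreeOn (tlo L lo k) (thi L hi k) V V') {n : ℕ} (hn : n ≤ k) {x : Site d} {ν : Fin d}
    (hx : tlo L lo n ≤ x) (hxν : x + e ν ≤ thi L hi n) :
    avgIter L V (k - n) x ν = avgIter L V' (k - n) x ν := by
  have hA : AgreeOn (tlo L lo n) (thi L hi n) (avgIter L V (k - n)) (avgIter L V' (k - n)) :=
    agree_level hL (k - n) n (by rw [show n + (k - n) = k by omega]; exact h)
  have hxx : x ≤ x + e ν := le_add_of_nonneg_right (B8Lemma1NonAbelian.e_nonneg ν)
  exact hA x ν (inBox_of_le hx (hxx.trans hxν)) (inBox_of_le (hx.trans hxx) hxν)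

/-! ## §3. `U₀″` and (1.133) for every orbit -/

/-- PRINT'S `U₀″` AS A FUNCTION OF `U₀` (p. 99 with p. 98): the cut-off to the finest cube `□̃ = [tlo k, thi k]`
of the gauge-fixed configuration `U₀′ = U₀^{u}`, `u = localGauge L lo hi U₀ k y` (the block axial tower gauge of
`B8Eq115GaugeFixing` with the global axial gauge of `Ū₀′ᵏ` on `□̃^{(k)} = [lo, hi]` at its center `y`).
[cite: Balaban1985RegularSpaces, p.98 ("We apply a gauge transformation to U₀ …"), p.99 (definition of U₀″)] -/
abbrev cutFixed (L : ℕ) (lo hi : Site d) (U : Site d → Fin d → 𝔸ˣ) (k : ℕ) (y : Site d) :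
    Site d → Fin d → 𝔸ˣ :=
  cutCfg (tlo L lo k) (thi L hi k) (gaugeAct (localGauge L lo hi U k y) U)

/-- **(1.132) [(1.7)- and `Ax`-parts] and (1.133), p. 99, FOR EVERY ORBIT, LOCAL CARRIER.**  Printed: "let us
define a configuration `U₀″` as equal to `U₀′` on `□̃`, and equal to `1` outside `□̃`. It satisfies the conditions
`U₀″ ∈ 𝔄_k({□_j}, L³α₀) ∩ Ax_k(ℭ_k, 1)`, (1.132) `|Ū₀″ʲ − 1| < 6dL²Mα₀` on `□_j^{(j)}`, `j = 0, 1, …, k`, (1.133)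
by the construction of `U₀″`, and the inequality (1.130)."  Certified form: for every `G`-valued `U₀` with (1.7)
on the unit plaquettes of the finest cube `□̃ = [tlo k, thi k]` (`sup |U₀(∂p) − 1| < α₀L²·L^{−2k}`), the Prop. 1/2
smallness of [3], a center `y` of the top cube `[lo, hi]` of half-width `h` with `2h ≤ M + 4R₁M₁`, `R₁M₁ ≤ M`,
`11d < M` and `11d²L²α₀ + (M + 4R₁M₁)dL²α₀ ≤ 1/6`, the configuration `U₀″ = cutFixed L lo hi U₀ k y` satisfies:
(i) it is `G`-valued; (ii) it is `1` on every bond not contained in `□̃`; (iii) its deviation (1.7) on `□̃` equals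
that of `U₀` (gauge invariance + locality) and is `< α₀L²·L^{−2k}`; (iv) (1.15) between all consecutive levels on
the tower of cubes, and the global axial gauge of `Ū₀″ᵏ` at `y` on `[lo, hi]`; (v) (1.133): for every depth
`n ≤ k` and every bond `⟨x, x + e_ν⟩` of the depth-`n` cube, `|Ū₀″^{k−n}(x, x + e_ν) − 1| < 6dL²Mα₀`.
Proof: `B8Eq115GaugeFixing.ineq130_fixed` for `U₀′`, transported to `U₀″` by `cutCfg_agree` and the locality
lemmas `pdevOn_congr`, `B8Ineq130.agree_level` / `axialFn_congr` / `hol_treeWord_congr`, `avgIter_eq_of_agree`.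
[cite: Balaban1985RegularSpaces, (1.132)-(1.133) p.99, (1.130) p.99, (1.15) p.78; Balaban1985Averaging, p.24] -/
theorem ineq133 (L : ℕ) (hL : 2 ≤ L) (hd : 1 ≤ d) {G : Subgroup 𝔸ˣ} (hG : AvgClosed d L G) (k : ℕ)
    (U : Site d → Fin d → 𝔸ˣ) (hU : ∀ x κ, U x κ ∈ G) {α₀ : ℝ} (hα : 0 < α₀)
    (hα3 : C0 d * (α₀ * (L : ℝ) ^ 2) ≤ 1 / 3) (hα2 : 2 * (α₀ * (L : ℝ) ^ 2) ≤ c2' d L)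
    (lo hi : Site d) (hlohi : lo ≤ hi)
    (h17 : pdevOn (tlo L lo k) (thi L hi k) U < α₀ * (L : ℝ) ^ 2 * (((L : ℝ) ^ k)⁻¹) ^ 2)
    {y : Site d} {h : ℕ} (hy : lo ≤ y) (hy' : y ≤ hi) (hrad : ∀ κ, y κ - lo κ ≤ h ∧ hi κ - y κ ≤ h)
    {M R₁ M₁ : ℝ} (hside : 2 * (h : ℝ) ≤ M + 4 * R₁ * M₁) (hRM : R₁ * M₁ ≤ M) (hM : 11 * (d : ℝ) < M)
    (hsmall : 11 * (d : ℝ) ^ 2 * (L : ℝ) ^ 2 * α₀ + (M + 4 * R₁ * M₁) * d * (L : ℝ) ^ 2 * α₀ ≤ 1 / 6) :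
    (∀ x κ, cutFixed L lo hi U k y x κ ∈ G) ∧
    (∀ x κ, ¬ (InBox (tlo L lo k) (thi L hi k) x ∧ InBox (tlo L lo k) (thi L hi k) (x + e κ)) →
      cutFixed L lo hi U k y x κ = 1) ∧
    (pdevOn (tlo L lo k) (thi L hi k) (cutFixed L lo hi U k y) = pdevOn (tlo L lo k) (thi L hi k) U ∧
      pdevOn (tlo L lo k) (thi L hi k) (cutFixed L lo hi U k y) < α₀ * (L : ℝ) ^ 2 * (((L : ℝ) ^ k)⁻¹) ^ 2) ∧
    (∀ n, n < k → ∀ z, tlo L lo n ≤ z → z ≤ thi L hi n → ∀ r : Fin d → Fin L,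
      axialFn (avgIter L (cutFixed L lo hi U k y) (k - (n + 1))) ((L : ℤ) • z) ((L : ℤ) • z + boxVec L r) = 1) ∧
    (∀ z, lo ≤ z → z ≤ hi → hol (avgIter L (cutFixed L lo hi U k y) k) y (treeWord (z - y)) = 1) ∧
    ∀ (n : ℕ), n ≤ k → ∀ (x : Site d) (ν : Fin d), tlo L lo n ≤ x → x + e ν ≤ thi L hi n →
      ‖((avgIter L (cutFixed L lo hi U k y) (k - n) x ν : 𝔸ˣ) : 𝔸) - 1‖ < 6 * d * (L : ℝ) ^ 2 * M * α₀ := by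
  have hL1 : 1 ≤ L := le_trans (by norm_num) hL
  obtain ⟨huG, h15', hgax', h130⟩ :=
    ineq130_fixed L hL hd hG k U hU hα hα3 hα2 lo hi hlohi h17 hy hy' hrad hside hRM hM hsmall
  have huU : ∀ x, localGauge L lo hi U k y x ∈ U1 𝔸 := fun x => hG.le_U1 (huG x)
  have hU' : ∀ x κ, gaugeAct (localGauge L lo hi U k y) U x κ ∈ G := gaugeAct_mem_of hU huG
  have hag : AgreeOn (tlo L lo k) (thi L hi k) (cutFixed L lo hi U k y)
      (gaugeAct (localGauge L lo hi U k y) U) := cutCfg_agree _ _ _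
  have hdev : pdevOn (tlo L lo k) (thi L hi k) (cutFixed L lo hi U k y) = pdevOn (tlo L lo k) (thi L hi k) U := by
    rw [pdevOn_congr hag, pdevOn_gaugeAct huU]
  refine ⟨fun x κ => cutCfg_mem hU' x κ, fun x κ hxκ => cutCfg_eq_one _ hxκ, ⟨hdev, hdev ▸ h17⟩, ?_, ?_, ?_⟩
  · intro n hn z hz hz' r
    have hA : AgreeOn (tlo L lo (n + 1)) (thi L hi (n + 1)) (avgIter L (cutFixed L lo hi U k y) (k - (n + 1)))
        (avgIter L (gaugeAct (localGauge L lo hi U k y) U) (k - (n + 1))) :=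
      agree_level hL1 (k - (n + 1)) (n + 1) (by rw [show n + 1 + (k - (n + 1)) = k by omega]; exact hag)
    obtain ⟨h1, h2⟩ := block_mem hz hz' r
    obtain ⟨h3, h4⟩ := smul_mem hL1 hz hz'
    rw [axialFn_congr hA _ _ (inBox_of_le h3 h4) (inBox_of_le h1 h2)]
    exact h15' n hn z hz hz' r
  · intro z hz hz'
    have hA : AgreeOn (tlo L lo 0) (thi L hi 0) (avgIter L (cutFixed L lo hi U k y) k)
        (avgIter L (gaugeAct (localGauge L lo hi U k y) U) k) :=
      agree_level hL1 k 0 (by rw [zero_add]; exact hag)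
    rw [tlo_zero, thi_zero] at hA
    rw [hol_treeWord_congr hA y (z - y) (inBox_of_le hy hy') (by rw [add_sub_cancel]; exact inBox_of_le hz hz')]
    exact hgax' z hz hz'
  · intro n hn x ν hx hxν
    rw [avgIter_eq_of_agree hL1 hag hn hx hxν]
    exact (h130 n hn x ν hx hxν).2.2.2

end Analytic

end Literature.MathematicalPhysics.QuantumFieldTheory.Balaban1983to89.B8Ineq133
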